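import Literature.Probability.LatticeModels.ProdBernoulliIndependence
import Mathlib.Tactic.Linarith
import HarnessLib

/-!
# Three increasing events pairwise meeting in a common top: the cell and Harris inequalities of a three-point side
# (input for the cross-cut certificate of frontier dec row 44)

Support file for crux `stmt-CriticalPhenomena-4575` (four-point decreasing `E₃` frontier, row 44), seat `prim-l12-p6` gen 15; memo
`run/shared/lean/prim/prim-l12/FROM-prim-l12-p6-g15-ROW44-CUT-VERTICES.md` §2.  No definitions, no named facts, no sorries.

On one side of a cut vertex `h` the three connection events `K = {x ↔ z}`, `A = {x ↔ h}`, `G = {z ↔ h}` of the three-point law of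
`(x, z, h)` are increasing and any two of them imply the third (`A ∩ G ⊆ K`, `A ∩ K ⊆ G`, `G ∩ K ⊆ A`), so all pairwise intersections are
the top cell `T = A ∩ G`.  In the variables `k = P(K)`, `a = P(A)`, `g = P(G)`, `t = P(T)` the five cells of the three-point partition
lattice are `1 − a − g − k + 2t, k − t, a − t, g − t, t` and Harris' inequality for the nine incomparable pairs of up-sets
(`K, A, G, K∪A, K∪G, A∪G`) reads as listed in `threePoint_side_facts` — exactly the hypotheses of
`FrontierDecRows.row44_crossCut_certificate` (`…FrontierDecRowsRow44CrossCutCertificate`) after that substitution.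
-/

noncomputable section

namespace Summit.CriticalPhenomena.PercolationContinuityZ3.Theorems.FrontierDecRows

open MeasureTheory Literature.Probability.LatticeModels

/-- **Cell and Harris facts of a three-point side.**  For increasing measurable events `K, A, G` under `prodBernoulli p` with
`A ∩ G ⊆ K`, `A ∩ K ⊆ G`, `G ∩ K ⊆ A` (so `T := A ∩ G` is the common pairwise intersection): the five cells are non-negative and
the nine Harris inequalities hold, in the variables `k = P(K), a = P(A), g = P(G), t = P(A ∩ G)`. [this work] -/
theorem threePoint_side_facts {ι : Type*} (p : ι → unitInterval) {K A G : Set (Set ι)}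
    (hK : IsUpperSet K) (hA : IsUpperSet A) (hG : IsUpperSet G)
    (hKm : MeasurableSet K) (hAm : MeasurableSet A) (hGm : MeasurableSet G)
    (hAG : A ∩ G ⊆ K) (hAK : A ∩ K ⊆ G) (hGK : G ∩ K ⊆ A) :
    (0 ≤ (prodBernoulli p).real (A ∩ G) ∧
      (prodBernoulli p).real (A ∩ G) ≤ (prodBernoulli p).real K ∧
      (prodBernoulli p).real (A ∩ G) ≤ (prodBernoulli p).real A ∧
      (prodBernoulli p).real (A ∩ G) ≤ (prodBernoulli p).real G ∧
      (prodBernoulli p).real A + (prodBernoulli p).real G + (prodBernoulli p).real K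
        - 2 * (prodBernoulli p).real (A ∩ G) ≤ 1) ∧
    ((prodBernoulli p).real K * (prodBernoulli p).real A ≤ (prodBernoulli p).real (A ∩ G) ∧
      (prodBernoulli p).real K * (prodBernoulli p).real G ≤ (prodBernoulli p).real (A ∩ G) ∧
      (prodBernoulli p).real A * (prodBernoulli p).real G ≤ (prodBernoulli p).real (A ∩ G)) ∧
    ((prodBernoulli p).real K *
        ((prodBernoulli p).real A + (prodBernoulli p).real G - (prodBernoulli p).real (A ∩ G)) ≤ (prodBernoulli p).real (A ∩ G) ∧
      (prodBernoulli p).real A *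
        ((prodBernoulli p).real K + (prodBernoulli p).real G - (prodBernoulli p).real (A ∩ G)) ≤ (prodBernoulli p).real (A ∩ G) ∧
      (prodBernoulli p).real G *
        ((prodBernoulli p).real K + (prodBernoulli p).real A - (prodBernoulli p).real (A ∩ G)) ≤ (prodBernoulli p).real (A ∩ G)) ∧
    (((prodBernoulli p).real K + (prodBernoulli p).real A - (prodBernoulli p).real (A ∩ G)) *
          ((prodBernoulli p).real A + (prodBernoulli p).real G - (prodBernoulli p).real (A ∩ G)) ≤ (prodBernoulli p).real A ∧
      ((prodBernoulli p).real K + (prodBernoulli p).real G - (prodBernoulli p).real (A ∩ G)) *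
          ((prodBernoulli p).real A + (prodBernoulli p).real G - (prodBernoulli p).real (A ∩ G)) ≤ (prodBernoulli p).real G ∧
      ((prodBernoulli p).real K + (prodBernoulli p).real A - (prodBernoulli p).real (A ∩ G)) *
          ((prodBernoulli p).real K + (prodBernoulli p).real G - (prodBernoulli p).real (A ∩ G)) ≤ (prodBernoulli p).real K) := by
  set μ := prodBernoulli p with hμ
  -- the common top
  have eAK : A ∩ K = A ∩ G :=
    Set.Subset.antisymm (fun ω h => ⟨h.1, hAK h⟩) (fun ω h => ⟨h.1, hAG h⟩)
  have eGK : G ∩ K = A ∩ G :=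
    Set.Subset.antisymm (fun ω h => ⟨hGK h, h.1⟩) (fun ω h => ⟨h.2, hAG h⟩)
  have eKA : K ∩ A = A ∩ G := by rw [Set.inter_comm]; exact eAK
  have eKG : K ∩ G = A ∩ G := by rw [Set.inter_comm]; exact eGK
  have hTm : MeasurableSet (A ∩ G) := hAm.inter hGm
  -- unions
  have uKA : μ.real (K ∪ A) = μ.real K + μ.real A - μ.real (A ∩ G) := by
    have := measureReal_union_add_inter (μ := μ) (s := K) hAm; rw [eKA] at this; linarith
  have uKG : μ.real (K ∪ G) = μ.real K + μ.real G - μ.real (A ∩ G) := by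
    have := measureReal_union_add_inter (μ := μ) (s := K) hGm; rw [eKG] at this; linarith
  have uAG : μ.real (A ∪ G) = μ.real A + μ.real G - μ.real (A ∩ G) := by
    have := measureReal_union_add_inter (μ := μ) (s := A) hGm; linarith
  -- intersections of unions
  have i1 : K ∩ (A ∪ G) = A ∩ G := by
    rw [Set.inter_union_distrib_left, eKA, eKG, Set.union_self]
  have i2 : A ∩ (K ∪ G) = A ∩ G := by
    rw [Set.inter_union_distrib_left, eAK, Set.union_self]
  have i3 : G ∩ (K ∪ A) = A ∩ G := by
    rw [Set.inter_union_distrib_left, eGK, Set.inter_comm G A, Set.union_self]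
  have i4 : (K ∪ A) ∩ (A ∪ G) = A := by
    apply Set.Subset.antisymm
    · rintro ω ⟨h1 | h1, h2 | h2⟩
      · exact h2
      · exact hGK ⟨h2, h1⟩
      · exact h1
      · exact h1
    · exact fun ω h => ⟨Or.inr h, Or.inl h⟩
  have i5 : (K ∪ G) ∩ (A ∪ G) = G := by
    apply Set.Subset.antisymm
    · rintro ω ⟨h1 | h1, h2 | h2⟩
      · exact hAK ⟨h2, h1⟩
      · exact h2
      · exact h1
      · exact h1
    · exact fun ω h => ⟨Or.inr h, Or.inr h⟩
  have i6 : (K ∪ A) ∩ (K ∪ G) = K := by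
    apply Set.Subset.antisymm
    · rintro ω ⟨h1 | h1, h2 | h2⟩
      · exact h1
      · exact h1
      · exact h2
      · exact hAG ⟨h1, h2⟩
    · exact fun ω h => ⟨Or.inl h, Or.inl h⟩
  -- the union of all three: K ∪ A ∪ G has measure k + a + g - 2t ≤ 1
  have i7 : (K ∪ A) ∩ G = A ∩ G := by rw [Set.inter_comm, i3]
  have u3 : μ.real (K ∪ A ∪ G) = μ.real K + μ.real A + μ.real G - 2 * μ.real (A ∩ G) := by
    have := measureReal_union_add_inter (μ := μ) (s := K ∪ A) hGm; rw [i7, uKA] at this; linarith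
  have le1 : μ.real (K ∪ A ∪ G) ≤ 1 := measureReal_le_one
  -- Harris for the nine pairs
  have H := fun {U V : Set (Set ι)} (hU : IsUpperSet U) (hV : IsUpperSet V) (hUm : MeasurableSet U) (hVm : MeasurableSet V) =>
    prodBernoulli_harris p hU hV hUm hVm
  have h1 := H hK hA hKm hAm
  have h2 := H hK hG hKm hGm
  have h3 := H hA hG hAm hGm
  have h4 := H hK (hA.union hG) hKm (hAm.union hGm)
  have h5 := H hA (hK.union hG) hAm (hKm.union hGm)
  have h6 := H hG (hK.union hA) hGm (hKm.union hAm)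
  have h7 := H (hK.union hA) (hA.union hG) (hKm.union hAm) (hAm.union hGm)
  have h8 := H (hK.union hG) (hA.union hG) (hKm.union hGm) (hAm.union hGm)
  have h9 := H (hK.union hA) (hK.union hG) (hKm.union hAm) (hKm.union hGm)
  rw [eKA] at h1; rw [eKG] at h2
  rw [i1, uAG] at h4; rw [i2, uKG] at h5; rw [i3, uKA] at h6
  rw [i4, uKA, uAG] at h7; rw [i5, uKG, uAG] at h8; rw [i6, uKA, uKG] at h9
  -- monotonicity
  have m1 : μ.real (A ∩ G) ≤ μ.real K := by rw [← eKA]; exact measureReal_mono Set.inter_subset_left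
  have m2 : μ.real (A ∩ G) ≤ μ.real A := measureReal_mono Set.inter_subset_left
  have m3 : μ.real (A ∩ G) ≤ μ.real G := measureReal_mono Set.inter_subset_right
  exact ⟨⟨measureReal_nonneg, m1, m2, m3, by linarith⟩, ⟨h1, h2, h3⟩, ⟨h4, h5, h6⟩, ⟨h7, h8, h9⟩⟩

end Summit.CriticalPhenomena.PercolationContinuityZ3.Theorems.FrontierDecRows
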